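import Literature.NumberTheory.LFunctions.AlternativeHypothesisConsequences
import Literature.NumberTheory.LFunctions.HardyZSignParity
import HarnessLib

/-!
# Same-ordinate pair count versus simple and critical zeros: Goldston–Suriajaya 2026, Theorem 2 (ii), (iii)

LABEL (cell `rh-split`, seat `rh-split-zd-neg` g13, carve of the referee-PASSed scratch kernel
`SketchG13Joint.lean` 35410d095c7b065d): **NOT RH-BEARING.** RH-FREE literature: two UNCONDITIONAL
finite counting inequalities about the zeros of `ζ`, PROVED (elementary deductions, D-0014), and
their ratio forms with the paper's hypothesis typed as an explicit PREDICATE (`CoincidentPairBound`,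
never asserted, never a Literature fact). WHAT THIS IS NOT: a claim about RH, about the pair
correlation conjecture, or about the size of `N⊛(T)`; nothing here bears on the truth of RH.

Topic `Literature/NumberTheory/LFunctions` (namespace `Literature.NumberTheory.LFunctions`, paper
objects in the sub-namespace `GLSS2026`, where the tree's `coincidentPairCount = N⊛` and part (i)
already live: `GLSS2026.two_mul_zetaZeroCount_sub_coincidentPairCount_le : 2·N(T) − N⊛(T) ≤ N⁽¹⁾(T)`
in `AlternativeHypothesisConsequences.lean`).

## Source (held text, locators opened 2026-08-27)

* [GoldstonSuriajaya2026] D. A. Goldston, A. I. Suriajaya, *Zeta Zeros in a Narrow Vertical Box*,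
  arXiv:2603.28104 (2026, PREPRINT; held `paper:arxiv-2603.28104`), §1 Theorem 2 (chunk p0006
  L5–L15: hypothesis (1.2) `N⊛(T) ≤ (C + o(1)) (T/2π) log T`; conclusions (i) proportion simple AND
  on the line `≥ 2 − C`, (ii) mean of the proportions of simple zeros and of critical zeros
  `≥ (3 − C)/2`, (iii) proportion simple OR critical `≥ (4 − C)/3`), p0006 L3: "Part iii) below is
  due to Soundararajan (in private communication)"; proved "by elementary reasoning" in the authors'
  *Zeta Zeros on the Critical Line*, arXiv:2511.20059. The deductions below ARE that elementary
  reasoning, carried out zero by zero in exact finite form (no `o(1)`), so the theorems are proved,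
  not named facts.

## Contents

* §1 dictionary: `N(T)`, `N*(T)` (`simpleZeroCount`), `N⁽¹⁾(T)` (`simpleCriticalZeroCount`),
  `N₀(T)` (`criticalZeroCount`) as sums / filtered cardinalities over the distinct zeros of
  `zetaZeroBox 0 T`;
* §2 the engine `exists_fiber_weight`: a weight `c ρ` (the number of zeros, with multiplicity, at
  the height of `ρ`) with `N⊛(T) = Σ_ρ m(ρ)·c ρ`, `c ρ ≥ m(ρ)` always and `c ρ ≥ 2m(ρ)` off the line
  (reflection `1 − ρ̄`: same height, same multiplicity, `riemannZetaZeroOrder_one_sub_conj`) —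
  steps (a)–(d) of the tree's proof of (i), packaged once;
* §3 `three_mul_zetaZeroCount_sub_coincidentPairCount_le : 3·N(T) − N⊛(T) ≤ N*(T) + N₀(T)` (ii) and
  `four_mul_zetaZeroCount_sub_coincidentPairCount_le : 4·N(T) − N⊛(T) ≤ 3·(N*(T) + N₀(T) − N⁽¹⁾(T))`
  (iii; the right side is `3·Σ_{ρ simple ∨ on the line} m(ρ)` by inclusion–exclusion);
* §4 the hypothesis shape `CoincidentPairBound C` (`N⊛(T) ≤ (C + ε)·N(T)` eventually, every
  `ε > 0`; with `N(T) ∼ (T/2π) log T` this is (1.2)) and the ratio corollaries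
  `simpleCritical_lower` ((i), from the tree), `simple_add_critical_lower` (ii),
  `simpleOrCritical_lower` (iii).
-/

noncomputable section

open Filter Real
open scoped Topology ComplexConjugate

namespace Literature.NumberTheory.LFunctions

namespace GLSS2026

/-! ## §1 Dictionary lemmas: the four counts as sums over the distinct zeros of the box -/

/-- `N(T) = Σ_ρ m(ρ)` over the distinct zeros `ρ` with `0 < Im ρ ≤ T`. [folklore] -/
private theorem zetaZeroCount_eq_sum_order (T : ℝ) :
    (zetaZeroCount T : ℤ) = ∑ ρ ∈ (zetaZeroBox_finite 0 T).toFinset, riemannZetaZeroOrder ρ := by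
  rw [zetaZeroCount_eq_finsum, finsum_mem_eq_finite_toFinset_sum _ (zetaZeroBox_finite 0 T)]

/-- `N*(T) = #{ρ : m(ρ) = 1}` over the distinct zeros of the box. [folklore] -/
private theorem simpleZeroCount_eq_card_filter (T : ℝ) :
    simpleZeroCount T =
      ((zetaZeroBox_finite 0 T).toFinset.filter fun ρ ↦ riemannZetaZeroOrder ρ = 1).card := by
  classical
  have hset : {ρ ∈ zetaZeroBox 0 T | riemannZetaZeroOrder ρ = 1} =
      ↑((zetaZeroBox_finite 0 T).toFinset.filter fun ρ ↦ riemannZetaZeroOrder ρ = 1) := by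
    ext ρ
    simp only [Set.mem_setOf_eq, Finset.coe_filter, Set.Finite.mem_toFinset]
  unfold simpleZeroCount
  rw [hset, Set.ncard_coe_finset]

/-- `N⁽¹⁾(T) = #{ρ : Re ρ = ½ ∧ m(ρ) = 1}` over the distinct zeros of the box (a zero on the line
lies in both boxes `zetaZeroBox (1/2) T ⊆ zetaZeroBox 0 T`). [folklore] -/
private theorem simpleCriticalZeroCount_eq_card (T : ℝ) :
    simpleCriticalZeroCount T =
      ((zetaZeroBox_finite 0 T).toFinset.filter
        fun ρ ↦ ρ.re = 1 / 2 ∧ riemannZetaZeroOrder ρ = 1).card := by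
  classical
  have hset : {ρ ∈ zetaZeroBox (1 / 2) T | ρ.re = 1 / 2 ∧ riemannZetaZeroOrder ρ = 1} =
      ↑((zetaZeroBox_finite 0 T).toFinset.filter
        fun ρ ↦ ρ.re = 1 / 2 ∧ riemannZetaZeroOrder ρ = 1) := by
    ext ρ
    simp only [Set.mem_setOf_eq, Finset.coe_filter, Set.Finite.mem_toFinset]
    constructor
    · rintro ⟨⟨h0, h1, h2, h3, h4⟩, h5, h6⟩
      exact ⟨⟨h0, by rw [h5]; norm_num, h2, h3, h4⟩, h5, h6⟩
    · rintro ⟨⟨h0, h1, h2, h3, h4⟩, h5, h6⟩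
      exact ⟨⟨h0, by rw [h5], h2, h3, h4⟩, h5, h6⟩
  unfold simpleCriticalZeroCount
  rw [hset, Set.ncard_coe_finset]

/-- `N₀(T) = Σ_{Re ρ = ½} m(ρ)` over the distinct zeros of the box. [folklore] -/
private theorem criticalZeroCount_eq_sum_filter (T : ℝ) :
    (criticalZeroCount T : ℤ) =
      ∑ ρ ∈ (zetaZeroBox_finite 0 T).toFinset.filter (fun ρ ↦ ρ.re = 1 / 2),
        riemannZetaZeroOrder ρ := by
  classical
  have hset : {ρ ∈ zetaZeroBox (1 / 2) T | ρ.re = 1 / 2} =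
      ↑((zetaZeroBox_finite 0 T).toFinset.filter fun ρ ↦ ρ.re = 1 / 2) := by
    ext ρ
    simp only [Set.mem_setOf_eq, Finset.coe_filter, Set.Finite.mem_toFinset]
    constructor
    · rintro ⟨⟨h0, h1, h2, h3, h4⟩, h5⟩
      exact ⟨⟨h0, by rw [h5]; norm_num, h2, h3, h4⟩, h5⟩
    · rintro ⟨⟨h0, h1, h2, h3, h4⟩, h5⟩
      exact ⟨⟨h0, by rw [h5], h2, h3, h4⟩, h5⟩
  rw [intCast_criticalZeroCount, hset, finsum_mem_coe_finset]

/-! ## §2 The engine: `N⊛ = Σ m·c`, `c ≥ m`, and `c ≥ 2m` off the line -/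

/-- **Fiber weights.** There is `c : ℂ → ℤ` (the number of zeros, with multiplicity, at the height
of `ρ`) with `N⊛(T) = Σ_ρ m(ρ)·c ρ` over the distinct zeros of the box, `m(ρ) ≤ c ρ` for every
zero, and `2m(ρ) ≤ c ρ` for every zero OFF the critical line (its reflection `1 − ρ̄ ≠ ρ` has the
same height and the same multiplicity). Steps (a)–(d) of the tree's
`GLSS2026.two_mul_zetaZeroCount_sub_coincidentPairCount_le`, packaged. [folklore] -/
private theorem exists_fiber_weight (T : ℝ) :
    ∃ c : ℂ → ℤ,
      ((coincidentPairCount T : ℤ) =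
          ∑ ρ ∈ (zetaZeroBox_finite 0 T).toFinset, riemannZetaZeroOrder ρ * c ρ) ∧
      (∀ ρ ∈ (zetaZeroBox_finite 0 T).toFinset, riemannZetaZeroOrder ρ ≤ c ρ) ∧
      (∀ ρ ∈ (zetaZeroBox_finite 0 T).toFinset, ρ.re ≠ 1 / 2 →
        2 * riemannZetaZeroOrder ρ ≤ c ρ) := by
  classical
  set B : Finset ℂ := (zetaZeroBox_finite 0 T).toFinset with hB
  set R : Finset ℕ := Finset.range (zetaZeroCount T) with hR
  obtain ⟨c, hc⟩ : ∃ c : ℝ → ℕ, ∀ v, c v = (R.filter fun n ↦ zetaOrdinate n = v).card :=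
    ⟨_, fun _ ↦ rfl⟩
  have hmemB : ∀ ρ, ρ ∈ B ↔ ρ ∈ zetaZeroBox 0 T := fun ρ ↦ Set.Finite.mem_toFinset _
  have hpos : ∀ ρ ∈ B, 0 < riemannZetaZeroOrder ρ := fun ρ hρ ↦
    DiophantineGeometry.riemannZetaZeroOrder_pos_of_mem_zetaZeroBox ((hmemB ρ).1 hρ)
  -- (a) `c(v) = Σ_{ρ ∈ B, Im ρ = v} m(ρ)`
  have hcv : ∀ v : ℝ, (c v : ℤ) = ∑ ρ ∈ B.filter (fun ρ ↦ ρ.im = v), riemannZetaZeroOrder ρ := by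
    intro v
    rw [hc, hR, Montgomery.card_filter_zetaOrdinate_eq T v]
    have hfin : {ρ | ρ ∈ zetaZeroBox 0 T ∧ ρ.im = v}.Finite :=
      (zetaZeroBox_finite 0 T).subset fun ρ h ↦ h.1
    rw [finsum_mem_eq_finite_toFinset_sum _ hfin]
    refine Finset.sum_congr ?_ fun _ _ ↦ rfl
    ext ρ
    simp [hB]
  -- (b) `N⊛(T) = Σ_{i < N(T)} c(γ_i)`
  have hD : (coincidentPairCount T : ℤ) = ∑ i ∈ R, (c (zetaOrdinate i) : ℤ) := by
    unfold coincidentPairCount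
    rw [Finset.card_filter, zeroIndexSet, Finset.sum_product]
    push_cast
    refine Finset.sum_congr rfl fun i _ ↦ ?_
    rw [hc, Finset.card_filter]
    push_cast
    exact Finset.sum_congr rfl fun j _ ↦ if_congr eq_comm rfl rfl
  -- (c) ordinate dictionary
  have hdict : ∀ f : ℝ → ℤ,
      ∑ i ∈ R, f (zetaOrdinate i) = ∑ ρ ∈ B, riemannZetaZeroOrder ρ * f ρ.im := by
    intro f
    have h := Montgomery.finsum_zetaZeroBox_mul_eq_sum_range (fun v ↦ ((f v : ℤ) : ℂ)) T
    rw [finsum_mem_eq_finite_toFinset_sum _ (zetaZeroBox_finite 0 T)] at h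
    exact_mod_cast h.symm
  refine ⟨fun ρ ↦ (c ρ.im : ℤ), hD.trans (hdict fun v ↦ (c v : ℤ)), ?_, ?_⟩
  · intro ρ hρ
    show riemannZetaZeroOrder ρ ≤ (c ρ.im : ℤ)
    rw [hcv]
    exact Finset.single_le_sum (f := riemannZetaZeroOrder)
      (fun ρ' hρ' ↦ (hpos ρ' (Finset.mem_filter.1 hρ').1).le) (Finset.mem_filter.2 ⟨hρ, rfl⟩)
  · intro ρ hρ hline
    show 2 * riemannZetaZeroOrder ρ ≤ (c ρ.im : ℤ)
    have hρbox : ρ ∈ zetaZeroBox 0 T := (hmemB ρ).1 hρ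
    have hm : 0 < riemannZetaZeroOrder ρ := hpos ρ hρ
    obtain ⟨hζ, -, -, him0, himT⟩ := hρbox
    have hre0 : 0 < ρ.re := DiophantineGeometry.re_pos_of_riemannZeta_eq_zero hζ him0.ne'
    have hre1 : ρ.re < 1 := DiophantineGeometry.re_lt_one_of_riemannZeta_eq_zero hζ
    have hord : riemannZetaZeroOrder (1 - conj ρ) = riemannZetaZeroOrder ρ :=
      riemannZetaZeroOrder_one_sub_conj hre0 hre1
    have hre' : (1 - conj ρ).re = 1 - ρ.re := by simp
    have him' : (1 - conj ρ).im = ρ.im := by simp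
    have hne1 : 1 - conj ρ ≠ 1 := by
      intro h
      have := congrArg Complex.im h
      rw [him'] at this
      simp at this
      linarith
    have hζ' : riemannZeta (1 - conj ρ) = 0 :=
      (riemannZetaZeroOrder_pos_iff hne1).1 (by rw [hord]; exact hm)
    have hρ'B : 1 - conj ρ ∈ B :=
      (hmemB _).2 ⟨hζ', by rw [hre']; linarith, by rw [hre']; linarith,
        by rw [him']; exact him0, by rw [him']; exact himT⟩
    have hne : 1 - conj ρ ≠ ρ := by
      intro h
      have := congrArg Complex.re h
      rw [hre'] at this
      apply hline
      linarith
    have hc2 : riemannZetaZeroOrder ρ + riemannZetaZeroOrder (1 - conj ρ) ≤ c ρ.im := by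
      rw [hcv, ← Finset.sum_pair hne.symm]
      refine Finset.sum_le_sum_of_subset_of_nonneg ?_ ?_
      · intro x hx
        rw [Finset.mem_insert, Finset.mem_singleton] at hx
        rcases hx with rfl | rfl
        · exact Finset.mem_filter.2 ⟨hρ, rfl⟩
        · exact Finset.mem_filter.2 ⟨hρ'B, him'⟩
      · intro x hx _
        exact (hpos x (Finset.mem_filter.1 hx).1).le
    rw [hord] at hc2
    linarith

/-! ## §3 Goldston–Suriajaya, Theorem 2 (ii) and (iii), exact finite forms (unconditional) -/

/-- **`3·N(T) − N⊛(T) ≤ N*(T) + N₀(T)`, unconditionally** (Goldston–Suriajaya arXiv:2603.28104,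
Theorem 2 (ii), finite form). Zero by zero: `3m − [m = 1] − [Re ρ = ½]·m ≤ m·c` in the four cases
(on/off the line) × (simple/multiple), using `c ≥ m` and `c ≥ 2m` off the line; then sum.
[cite: GoldstonSuriajaya2026, Theorem 2 (ii)] -/
theorem three_mul_zetaZeroCount_sub_coincidentPairCount_le (T : ℝ) :
    (3 * zetaZeroCount T : ℤ) - coincidentPairCount T ≤ simpleZeroCount T + criticalZeroCount T := by
  classical
  obtain ⟨c, hD, hc1, hc2⟩ := exists_fiber_weight T
  have hN := zetaZeroCount_eq_sum_order T
  set B : Finset ℂ := (zetaZeroBox_finite 0 T).toFinset with hB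
  have hpos : ∀ ρ ∈ B, 0 < riemannZetaZeroOrder ρ := fun ρ hρ ↦
    DiophantineGeometry.riemannZetaZeroOrder_pos_of_mem_zetaZeroBox
      ((Set.Finite.mem_toFinset _).1 hρ)
  have hkey : ∀ ρ ∈ B, 3 * riemannZetaZeroOrder ρ -
      ((if riemannZetaZeroOrder ρ = 1 then (1 : ℤ) else 0) +
        (if ρ.re = 1 / 2 then riemannZetaZeroOrder ρ else 0)) ≤
        riemannZetaZeroOrder ρ * c ρ := by
    intro ρ hρ
    have hm := hpos ρ hρ
    have h1 := hc1 ρ hρ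
    by_cases hline : ρ.re = 1 / 2 <;> by_cases hs : riemannZetaZeroOrder ρ = 1
    · rw [if_pos hs, if_pos hline, hs]
      rw [hs] at h1
      linarith
    · rw [if_neg hs, if_pos hline]
      have hm2 : 2 ≤ riemannZetaZeroOrder ρ := by omega
      nlinarith [mul_le_mul_of_nonneg_left h1 hm.le, hm2]
    · have h2 := hc2 ρ hρ hline
      rw [if_pos hs, if_neg hline, hs]
      rw [hs] at h2
      linarith
    · have h2 := hc2 ρ hρ hline
      rw [if_neg hs, if_neg hline]
      have hm2 : 2 ≤ riemannZetaZeroOrder ρ := by omega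
      nlinarith [mul_le_mul_of_nonneg_left h2 hm.le, hm2]
  have hsum := Finset.sum_le_sum hkey
  rw [Finset.sum_sub_distrib, Finset.sum_add_distrib, ← Finset.mul_sum, ← hN, ← hD,
    Finset.sum_boole, ← Finset.sum_filter] at hsum
  rw [simpleZeroCount_eq_card_filter, criticalZeroCount_eq_sum_filter, ← hB]
  linarith [hsum]

/-- **`4·N(T) − N⊛(T) ≤ 3·(N*(T) + N₀(T) − N⁽¹⁾(T))`, unconditionally** (Goldston–Suriajaya
arXiv:2603.28104, Theorem 2 (iii), due to Soundararajan; finite form). The right side is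
`3·Σ_{ρ simple ∨ Re ρ = ½} m(ρ)` by inclusion–exclusion; zero by zero
`4m − 3·[m = 1 ∨ Re ρ = ½]·m ≤ m·c`. [cite: GoldstonSuriajaya2026, Theorem 2 (iii)] -/
theorem four_mul_zetaZeroCount_sub_coincidentPairCount_le (T : ℝ) :
    (4 * zetaZeroCount T : ℤ) - coincidentPairCount T ≤
      3 * ((simpleZeroCount T : ℤ) + criticalZeroCount T - simpleCriticalZeroCount T) := by
  classical
  obtain ⟨c, hD, hc1, hc2⟩ := exists_fiber_weight T
  have hN := zetaZeroCount_eq_sum_order T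
  set B : Finset ℂ := (zetaZeroBox_finite 0 T).toFinset with hB
  have hpos : ∀ ρ ∈ B, 0 < riemannZetaZeroOrder ρ := fun ρ hρ ↦
    DiophantineGeometry.riemannZetaZeroOrder_pos_of_mem_zetaZeroBox
      ((Set.Finite.mem_toFinset _).1 hρ)
  have hkey : ∀ ρ ∈ B, 4 * riemannZetaZeroOrder ρ -
      3 * ((if riemannZetaZeroOrder ρ = 1 then (1 : ℤ) else 0) +
        (if ρ.re = 1 / 2 then riemannZetaZeroOrder ρ else 0) -
        (if ρ.re = 1 / 2 ∧ riemannZetaZeroOrder ρ = 1 then (1 : ℤ) else 0)) ≤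
        riemannZetaZeroOrder ρ * c ρ := by
    intro ρ hρ
    have hm := hpos ρ hρ
    have h1 := hc1 ρ hρ
    by_cases hline : ρ.re = 1 / 2 <;> by_cases hs : riemannZetaZeroOrder ρ = 1
    · rw [if_pos hs, if_pos hline,
        if_pos (show ρ.re = 1 / 2 ∧ riemannZetaZeroOrder ρ = 1 from ⟨hline, hs⟩), hs]
      rw [hs] at h1
      linarith
    · rw [if_neg hs, if_pos hline,
        if_neg (show ¬(ρ.re = 1 / 2 ∧ riemannZetaZeroOrder ρ = 1) from fun h ↦ hs h.2)]
      nlinarith [mul_le_mul_of_nonneg_left h1 hm.le, hm]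
    · have h2 := hc2 ρ hρ hline
      rw [if_pos hs, if_neg hline,
        if_neg (show ¬(ρ.re = 1 / 2 ∧ riemannZetaZeroOrder ρ = 1) from fun h ↦ hline h.1), hs]
      rw [hs] at h2
      linarith
    · have h2 := hc2 ρ hρ hline
      rw [if_neg hs, if_neg hline,
        if_neg (show ¬(ρ.re = 1 / 2 ∧ riemannZetaZeroOrder ρ = 1) from fun h ↦ hline h.1)]
      have hm2 : 2 ≤ riemannZetaZeroOrder ρ := by omega
      nlinarith [mul_le_mul_of_nonneg_left h2 hm.le, hm2]
  have hsum := Finset.sum_le_sum hkey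
  rw [Finset.sum_sub_distrib, ← Finset.mul_sum, ← Finset.mul_sum, Finset.sum_sub_distrib,
    Finset.sum_add_distrib, ← hN, ← hD, Finset.sum_boole, Finset.sum_boole,
    ← Finset.sum_filter] at hsum
  rw [simpleZeroCount_eq_card_filter, criticalZeroCount_eq_sum_filter,
    simpleCriticalZeroCount_eq_card, ← hB]
  linarith [hsum]

/-! ## §4 Ratio corollaries under a bound on the same-ordinate pair count -/

/-- HYPOTHESIS SHAPE (Goldston–Suriajaya's (1.2), normalised by `N(T)` instead of `(T/2π) log T`):
`N⊛(T) ≤ (C + ε)·N(T)` for all large `T`, every `ε > 0`. Never asserted here; `C = 1` is (ES1)-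
strength (`GLSS2026.ES1`), `C = 4/3` is what the narrow-box hypothesis buys (their §8, chunk p0010
L64), and under RH — one zero per height, so `N⊛(T) = Σ_{0<γ≤T} m_ρ` counted with multiplicity,
the quantity bounded in `CGdL2020.NStarLe` — `C = 1.3208` is admissible
(`chirreGoncalvesDeLaat2020_theorem1`, a named fact). Only `C ≥ 1` is interesting:
`N(T) ≤ N⊛(T)` (`zetaZeroCount_le_coincidentPairCount`). [cite: GoldstonSuriajaya2026, Theorem 2 hypothesis (1.2)] -/
def CoincidentPairBound (C : ℝ) : Prop :=
  ∀ ε : ℝ, 0 < ε → ∀ᶠ T : ℝ in atTop, (coincidentPairCount T : ℝ) ≤ (C + ε) * zetaZeroCount T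

/-- (i) in ratio form: `(2 − C − ε)·N(T) ≤ N⁽¹⁾(T)` eventually — at least `2 − C` of the zeros are
simple AND on the line (the tree's count + the hypothesis shape). [cite: GoldstonSuriajaya2026, Theorem 2 (i)] -/
theorem simpleCritical_lower {C : ℝ} (h : CoincidentPairBound C) (ε : ℝ) (hε : 0 < ε) :
    ∀ᶠ T : ℝ in atTop, (2 - C - ε) * (zetaZeroCount T : ℝ) ≤ simpleCriticalZeroCount T := by
  filter_upwards [h ε hε] with T hT
  have h2 : (2 * zetaZeroCount T : ℝ) - coincidentPairCount T ≤ simpleCriticalZeroCount T := by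
    exact_mod_cast two_mul_zetaZeroCount_sub_coincidentPairCount_le T
  nlinarith [h2, hT, Nat.cast_nonneg (α := ℝ) (zetaZeroCount T)]

/-- (ii) in ratio form: `(3 − C − ε)·N(T) ≤ N*(T) + N₀(T)` eventually — the mean of the simple and
critical proportions is at least `(3 − C)/2`. [cite: GoldstonSuriajaya2026, Theorem 2 (ii)] -/
theorem simple_add_critical_lower {C : ℝ} (h : CoincidentPairBound C) (ε : ℝ) (hε : 0 < ε) :
    ∀ᶠ T : ℝ in atTop,
      (3 - C - ε) * (zetaZeroCount T : ℝ) ≤ (simpleZeroCount T : ℝ) + criticalZeroCount T := by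
  filter_upwards [h ε hε] with T hT
  have h3 : (3 * zetaZeroCount T : ℝ) - coincidentPairCount T ≤
      (simpleZeroCount T : ℝ) + criticalZeroCount T := by
    exact_mod_cast three_mul_zetaZeroCount_sub_coincidentPairCount_le T
  nlinarith [h3, hT, Nat.cast_nonneg (α := ℝ) (zetaZeroCount T)]

/-- (iii) in ratio form: `(4 − C − ε)·N(T) ≤ 3·(N*(T) + N₀(T) − N⁽¹⁾(T))` eventually — at least
`(4 − C)/3` of the zeros are simple OR on the line. [cite: GoldstonSuriajaya2026, Theorem 2 (iii)] -/
theorem simpleOrCritical_lower {C : ℝ} (h : CoincidentPairBound C) (ε : ℝ) (hε : 0 < ε) :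
    ∀ᶠ T : ℝ in atTop,
      (4 - C - ε) * (zetaZeroCount T : ℝ) ≤
        3 * ((simpleZeroCount T : ℝ) + criticalZeroCount T - simpleCriticalZeroCount T) := by
  filter_upwards [h ε hε] with T hT
  have h4 : (4 * zetaZeroCount T : ℝ) - coincidentPairCount T ≤
      3 * ((simpleZeroCount T : ℝ) + criticalZeroCount T - simpleCriticalZeroCount T) := by
    exact_mod_cast four_mul_zetaZeroCount_sub_coincidentPairCount_le T
  nlinarith [h4, hT, Nat.cast_nonneg (α := ℝ) (zetaZeroCount T)]

end GLSS2026

end Literature.NumberTheory.LFunctions
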